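import Literature.NumberTheory.LFunctions.ClassGroupLogFreeZeroSide
import Literature.NumberTheory.LFunctions.ClassGroupLogFreeSieveConst
import HarnessLib

/-!
# Bombieri's Théorème 14 for the class group characters of a number field, II: the middle range

Topic `Literature/NumberTheory/LFunctions`, namespace `Literature.NumberTheory.LFunctions.NumberField`.
Everything here is PROVED (theorems only; no named facts).

The class-group counterpart of `LogFreeDensity.middleRange` (Bombieri, *Le grand crible*, §6,
Théorème 14, pp. 48–50): for a number field `K` of degree `n_K ≤ 4` whose non-trivial class group
`L`-functions do not vanish on `Re s ≥ 1`, and a size parameter `P ≥ 2` with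
`|d_K|, h_K ≤ P` and `κ_K ≥ 1/P`, any finite sets `Z(χ)` of zeros of `L₀(s, χ)` (`χ ≠ 1`) in
`0 < β < 1`, `|γ| ≤ P`, and `c₀/log P ≤ 1 − α ≤ δ₀`:

  `Σ_{χ ≠ 1} Σ_{ρ ∈ Z(χ), β ≥ α} m(ρ) ≤ C P^{A(1−α)}`   (`middleRange_CG`).

The zero side is `zeroSide_CG` (Lemme B for `L₀`, summed over the zeros), the sieve side is the
log-free mean value theorem for `Ĉl_K` (`sieveSide_classGroup` with `card_mul_meanValueConst_le`,
`balancePoint_le`, `secondary_le`: `h_K M ≪ 1/log x`), in place of Bombieri's Théorème 11.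

## References

* [Bombieri1987GrandCrible] E. Bombieri, Astérisque 18 (1987), §6 Théorème 14, pp. 48–50.
* [ThornerZaman2017] J. Thorner, A. Zaman, Algebra Number Theory 11 (2017), Theorem 4.2, §5.
-/

noncomputable section

open Complex Finset Filter Real MeasureTheory
open scoped LSeries.notation ArithmeticFunction.vonMangoldt Topology Nat

namespace Literature.NumberTheory.LFunctions.NumberField

open Literature.NumberTheory.LFunctions.LogFreeLocal Literature.NumberTheory.LFunctions.LogFreeDensity
  Literature.NumberTheory.LFunctions.AbelianDensity
open scoped nonZeroDivisors _root_.NumberField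

variable {K : Type*} [Field K] [NumberField K]

/-! ### Elementary inputs -/

omit [NumberField K] in
/-- `ψ ≠ 0 → χ_ψ ≠ 1`. [folklore] -/
theorem toHomUnits_ne_one {ψ : AddChar (Additive (ClassGroup (𝓞 K))) ℂ} (hψ : ψ ≠ 0) :
    (toMulHom ψ).toHomUnits ≠ 1 := by
  intro h1
  apply hψ
  refine toHomUnits_toMulHom_injective (K := K) ?_
  show (toMulHom ψ).toHomUnits = (toMulHom 0).toHomUnits
  rw [h1]
  refine MonoidHom.ext fun C ↦ Units.ext ?_
  rw [toHomUnits_toMulHom_apply]; simp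

/-- **The height bound**: for `n_K ≤ 4`, `|d_K| ≤ P`, `P ≥ 2` and `|v| ≤ P + 1`,
`ℒ'_v = lemmaAHeight K v ≤ 84839040 · log P`. [folklore] -/
theorem lemmaAHeight_le {P : ℝ} (hP : 2 ≤ P) (hn : Module.finrank ℚ K ≤ 4)
    (hd : ((NumberField.discr K).natAbs : ℝ) ≤ P) {v : ℝ} (hv : |v| ≤ P + 1) :
    lemmaAHeight K v ≤ 84839040 * Real.log P := by
  set Lp := Real.log P with hLp
  have hP0 : 0 < P := by linarith
  have hl2 : (0.69 : ℝ) ≤ Lp := by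
    have := Real.log_two_gt_d9; have := Real.log_le_log (by norm_num) hP; rw [hLp]; linarith
  have hn4 : (Module.finrank ℚ K : ℝ) ≤ 4 := by exact_mod_cast hn
  have hn0 : (0 : ℝ) ≤ Module.finrank ℚ K := Nat.cast_nonneg _
  have hd1 : (1 : ℝ) ≤ ((NumberField.discr K).natAbs : ℝ) := one_le_natAbs_discr
  have hlogd : Real.log ((NumberField.discr K).natAbs : ℝ) ≤ Lp := Real.log_le_log (by linarith) hd
  have hlogv : Real.log (|v| + 7) ≤ 5 * Lp := by
    have h1 : Real.log (|v| + 7) ≤ Real.log (5 * P) := Real.log_le_log (by positivity) (by linarith)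
    rw [Real.log_mul (by norm_num) hP0.ne'] at h1
    have h5 : Real.log 5 ≤ 2 := by
      have : Real.log 5 ≤ Real.log (Real.exp 2) := by
        refine Real.log_le_log (by norm_num) ?_
        have := Real.exp_one_gt_d9
        have h : Real.exp 2 = Real.exp 1 * Real.exp 1 := by rw [← Real.exp_add]; norm_num
        rw [h]; nlinarith
      rwa [Real.log_exp] at this
    nlinarith
  have hlv0 : 0 ≤ Real.log (|v| + 7) := le_trans zero_le_one (one_le_log_abs_add_seven v)
  have hdisc : discBound K v ≤ 44 * Lp := by
    rw [discBound]
    have hprod : ((Module.finrank ℚ K : ℝ) + 1) * Real.log (|v| + 7) ≤ 5 * (5 * Lp) :=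
      mul_le_mul (by linarith) hlogv hlv0 (by norm_num)
    nlinarith
  rw [lemmaAHeight]
  have hcoef : 77760 * (5 * (Module.finrank ℚ K : ℝ) + 2) + 217440 ≤ 1928160 := by nlinarith
  have hdb0 : 0 ≤ discBound K v := le_trans zero_le_one (one_le_discBound K v)
  calc (77760 * (5 * (Module.finrank ℚ K : ℝ) + 2) + 217440) * discBound K v ≤ 1928160 * (44 * Lp) :=
        mul_le_mul hcoef hdisc hdb0 (by norm_num)
    _ = 84839040 * Lp := by ring

/-- `log y ≤ a₀ y/16` for `y ≥ 1500/a₀` (`a₀ = expoB = 1/(480 e^{14})`). [folklore] -/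
theorem log_le_expoB_mul {y : ℝ} (hy : 1500 / expoB ≤ y) : Real.log y ≤ expoB * y / 16 := by
  have ha : 0 < expoB := expoB_pos
  set t : ℝ := expoB * y with ht
  have ht1500 : 1500 ≤ t := by rw [ht]; rwa [div_le_iff₀ ha, mul_comm] at hy
  have hy0 : 0 < y := lt_of_lt_of_le (by positivity) hy
  have hlogy : Real.log y = Real.log t + Real.log 480 + 14 := by
    rw [ht, Real.log_mul ha.ne' hy0.ne', expoB, one_div, Real.log_inv, Real.log_mul (by norm_num) (Real.exp_pos _).ne',
      Real.log_exp]
    ring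
  have hlogt : Real.log t ≤ t / 64 + 4.2 := by
    have h1 : Real.log (t / 64) ≤ t / 64 - 1 := Real.log_le_sub_one_of_pos (by positivity)
    rw [Real.log_div (by positivity) (by norm_num)] at h1
    have h64 : Real.log 64 ≤ 4.2 := by
      rw [show (64 : ℝ) = 2 ^ 6 by norm_num, Real.log_pow]; have := Real.log_two_lt_d9; norm_num; linarith
    linarith
  have h480 : Real.log 480 ≤ 6.5 := by
    rw [show (480 : ℝ) = 2 ^ 5 * 15 by norm_num, Real.log_mul (by norm_num) (by norm_num), Real.log_pow]
    have := Real.log_two_lt_d9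
    have h15 : Real.log 15 ≤ 3 := by
      have : Real.log 15 ≤ Real.log (Real.exp 3) := by
        refine Real.log_le_log (by norm_num) ?_
        have h1 : Real.exp 3 = Real.exp 1 * Real.exp 1 * Real.exp 1 := by rw [← Real.exp_add, ← Real.exp_add]; norm_num
        have := Real.exp_one_gt_d9
        rw [h1]; nlinarith [Real.exp_pos (1:ℝ)]
      rwa [Real.log_exp] at this
    norm_num; linarith
  rw [hlogy, show expoB * y / 16 = t / 16 by rw [ht]]
  linarith

/-- `Σ_{n ≤ N} Λ(n) log n/n ≤ log N · (log N + log 4 + 2)`. [folklore] -/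
theorem sum_vonMangoldt_mul_log_div_le (N : ℕ) :
    ∑ n ∈ Icc 1 N, Λ n * Real.log n / n ≤ Real.log N * (Real.log N + Real.log 4 + 2) := by
  have h1 : ∀ n ∈ Icc 1 N, Λ n * Real.log n / n ≤ Real.log N * (Λ n / n) := by
    intro n hn
    rw [mem_Icc] at hn
    have hn0 : (0 : ℝ) < n := by exact_mod_cast hn.1
    have hlog : Real.log n ≤ Real.log N := Real.log_le_log hn0 (by exact_mod_cast hn.2)
    calc Λ n * Real.log n / n = Real.log n * (Λ n / n) := by ring
      _ ≤ Real.log N * (Λ n / n) :=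
          mul_le_mul_of_nonneg_right hlog (div_nonneg ArithmeticFunction.vonMangoldt_nonneg hn0.le)
  refine (sum_le_sum h1).trans ?_
  rw [← mul_sum]
  exact mul_le_mul_of_nonneg_left (sum_vonMangoldt_div_le N) (Real.log_natCast_nonneg N)

/-! ### The middle range -/

set_option maxHeartbeats 1600000 in
open scoped Classical in
/-- **Théorème 14 for `Ĉl_K` in the middle range** (Bombieri pp. 48–50 with the log-free mean value
theorem of Thorner–Zaman in place of Théorème 11): for every `c₀ > 0` there are absolute
`δ₀, A, C > 0` such that for every number field `K` with `n_K ≤ 4` whose `L₀(s, χ)`, `χ ≠ 1`, do not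
vanish on `Re s ≥ 1`, every `P ≥ 2` with `|d_K| ≤ P`, `h_K ≤ P`, `κ_K ≥ 1/P`, all finite sets `Z(χ)`
of zeros of `L₀(s, χ)` in `0 < β < 1`, `|γ| ≤ P`, and `c₀/log P ≤ 1 − α ≤ δ₀`:
`Σ_{ψ ≠ 0} Σ_{ρ ∈ Z(χ_ψ), β ≥ α} m(ρ) ≤ C P^{A(1−α)}`. [cite: Bombieri1987GrandCrible, §6 Théorème 14] -/
theorem middleRange_CG {c₀ : ℝ} (hc₀ : 0 < c₀) :
    ∃ δ₀ A C : ℝ, 0 < δ₀ ∧ 0 < A ∧ 0 < C ∧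
      ∀ (K : Type*) [Field K] [NumberField K], Module.finrank ℚ K ≤ 4 →
        (∀ χ : ClassGroup (𝓞 K) →* ℂˣ, χ ≠ 1 → ∀ ρ : ℂ, classGroupLFunction₀ K χ ρ = 0 → ρ.re < 1) →
        ∀ P : ℝ, 2 ≤ P → ((NumberField.discr K).natAbs : ℝ) ≤ P →
          (Fintype.card (ClassGroup (𝓞 K)) : ℝ) ≤ P → P⁻¹ ≤ NumberField.dedekindZeta_residue K →
        ∀ Z : (ClassGroup (𝓞 K) →* ℂˣ) → Finset ℂ,
          (∀ χ : ClassGroup (𝓞 K) →* ℂˣ, χ ≠ 1 → ∀ ρ ∈ Z χ,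
              classGroupLFunction₀ K χ ρ = 0 ∧ 0 < ρ.re ∧ ρ.re < 1 ∧ |ρ.im| ≤ P) →
          ∀ α : ℝ, c₀ / Real.log P ≤ 1 - α → 1 - α ≤ δ₀ →
            ∑ ψ : AddChar (Additive (ClassGroup (𝓞 K))) ℂ with ψ ≠ 0,
              ∑ ρ ∈ Z (toMulHom ψ).toHomUnits with α ≤ ρ.re,
                (zeroOrder (classGroupLFunction₀ K (toMulHom ψ).toHomUnits) ρ : ℝ) ≤ C * P ^ (A * (1 - α)) := by
  obtain ⟨A₀, r₀, C_z, hA₀, hr₀, hC_z, hZS⟩ := zeroSide_CG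
  set a : ℝ := expoB with ha
  have hapos : 0 < a := expoB_pos
  have ha1 : a ≤ 1 / 2 := expoB_le_half
  set B : ℝ := max 84839040 (max 8 (1 / (2 * c₀))) with hB
  have hB0 : (84839040 : ℝ) ≤ B := le_max_left _ _
  have hB8 : 8 ≤ B := (le_max_left _ _).trans (le_max_right _ _)
  have hBc : 1 / (2 * c₀) ≤ B := (le_max_right _ _).trans (le_max_right _ _)
  have hBpos : 0 < B := by linarith
  set A₁ : ℝ := max A₀ (2200 / (a * B)) with hA₁
  have hA₁pos : 0 < A₁ := lt_of_lt_of_le hA₀ (le_max_left _ _)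
  have hA₁A₀ : A₀ ≤ A₁ := le_max_left _ _
  have hA₁a : 2200 / (a * B) ≤ A₁ := le_max_right _ _
  set C_M : ℝ := 512 * Real.exp 4 / a + 1 with hC_M
  have hC_Mpos : 0 < C_M := by positivity
  set K₁ : ℝ := 256 * π * C_z * C_M * A₁ ^ 2 * B ^ 3 with hK₁
  refine ⟨min (r₀ / 2) (1 / 2), (A₁ * B / 10 + 3) * 2, K₁ * Real.exp 10,
    by positivity, by positivity, by positivity, fun K _ _ hnK hline P hP hd hh hκ Z hZ α hα1 hα2 => ?_⟩
  /- ── parameters ── -/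
  have hPpos : 0 < P := by linarith
  set Lp : ℝ := Real.log P with hLp
  have hLp2 : Real.log 2 ≤ Lp := Real.log_le_log (by norm_num) hP
  have hlog2 : (0.69 : ℝ) ≤ Real.log 2 := by have := Real.log_two_gt_d9; linarith
  have hLppos : 0 < Lp := by linarith
  set r : ℝ := 2 * (1 - α) with hr
  have hδ : 1 - α ≤ r₀ / 2 := hα2.trans (min_le_left _ _)
  have hδ' : 1 - α ≤ 1 / 2 := hα2.trans (min_le_right _ _)
  have h1α : c₀ / Lp ≤ 1 - α := hα1
  have h1αpos : 0 < 1 - α := lt_of_lt_of_le (by positivity) h1α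
  have hrpos : 0 < r := by rw [hr]; linarith
  have hrr₀ : r ≤ r₀ := by rw [hr]; linarith
  have hr1 : r ≤ 1 := by rw [hr]; linarith
  set L' : ℝ := B * Lp with hL'
  have hL'8 : 8 * Lp ≤ L' := by rw [hL']; exact mul_le_mul_of_nonneg_right hB8 hLppos.le
  have hL'1 : 1 ≤ L' := by linarith
  have hu : 1 ≤ r * L' := by
    rw [hr, hL']
    have h1 : c₀ ≤ (1 - α) * Lp := by rwa [div_le_iff₀ hLppos] at h1α
    have h2 : 1 ≤ 2 * c₀ * B := by
      rw [div_le_iff₀ (by positivity)] at hBc; linarith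
    calc (1 : ℝ) ≤ 2 * c₀ * B := h2
      _ ≤ 2 * ((1 - α) * Lp) * B := by nlinarith only [h1, hBpos, hc₀]
      _ = 2 * (1 - α) * (B * Lp) := by ring
  set Lx : ℝ := A₁ * L' with hLx
  set x : ℝ := Real.exp Lx with hx
  have hxpos : 0 < x := Real.exp_pos _
  have hlogx : Real.log x = Lx := Real.log_exp _
  have hLxA₀ : A₀ * L' ≤ Real.log x := by
    rw [hlogx, hLx]; exact mul_le_mul_of_nonneg_right hA₁A₀ (by positivity)
  have haLx : 2200 * Lp ≤ a * Lx := by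
    rw [hLx, hL']
    have h1 : 2200 / (a * B) * (B * Lp) ≤ A₁ * (B * Lp) :=
      mul_le_mul_of_nonneg_right hA₁a (by positivity)
    have h2 : a * (2200 / (a * B) * (B * Lp)) = 2200 * Lp := by field_simp
    calc 2200 * Lp = a * (2200 / (a * B) * (B * Lp)) := h2.symm
      _ ≤ a * (A₁ * (B * Lp)) := mul_le_mul_of_nonneg_left h1 hapos.le
  have haLx1500 : 1500 ≤ a * Lx := by linarith
  have hLxnn : 0 ≤ Lx := by rw [hLx]; positivity
  have hLx4 : 4 ≤ Lx := by nlinarith only [ha1, hLxnn, haLx1500, hapos]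
  have hLx1 : 1 ≤ Lx := by linarith
  have hx1 : 1 ≤ x := by rw [hx]; exact Real.one_le_exp (by linarith)
  set T' : ℝ := P + 1 with hT'
  have hT'1 : 1 ≤ T' := by rw [hT']; linarith
  have hT'0 : 0 ≤ T' := by linarith
  have hT'pos : 0 < T' := by linarith
  have hT'2 : T' ≤ 2 * P := by rw [hT']; linarith
  /- ── `NX = ⌊x^{a₀}⌋`, `w = NX^{1/8}`, `z = ⌊w⌋` ── -/
  set NX : ℕ := ⌊x ^ a⌋₊ with hNX
  have hxa : x ^ a = Real.exp (a * Lx) := by rw [hx, ← Real.exp_mul, mul_comm]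
  have hxa512 : (512 : ℝ) ≤ x ^ a := by
    rw [hxa]; linarith [Real.add_one_le_exp (a * Lx)]
  have hNXle : (NX : ℝ) ≤ x ^ a := Nat.floor_le (by positivity)
  have hNXgt : x ^ a < NX + 1 := Nat.lt_floor_add_one _
  have hNXhalf : x ^ a / 2 ≤ NX := by linarith
  have hNX256 : (256 : ℝ) ≤ NX := by linarith
  have hNX1 : 1 ≤ NX := by exact_mod_cast (show (1 : ℝ) ≤ NX by linarith)
  have hNXpos : (0 : ℝ) < NX := by linarith
  have hlogNX : a * Lx - 1 ≤ Real.log NX := by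
    have h1 : Real.log (x ^ a / 2) ≤ Real.log NX := Real.log_le_log (by positivity) hNXhalf
    rw [Real.log_div (by positivity) two_ne_zero, hxa, Real.log_exp] at h1
    have := Real.log_two_lt_d9
    linarith
  obtain ⟨w, hw⟩ : ∃ w : ℝ, w = (NX : ℝ) ^ ((1 : ℝ) / 8) := ⟨_, rfl⟩
  have hw0 : 0 < w := by rw [hw]; exact Real.rpow_pos_of_pos hNXpos _
  have hw8 : w ^ 8 = NX := by
    rw [hw, ← Real.rpow_natCast, ← Real.rpow_mul hNXpos.le]; norm_num
  have hw2 : 2 ≤ w := by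
    have : (2 : ℝ) ^ 8 ≤ w ^ 8 := by
      rw [hw8]
      calc (2 : ℝ) ^ 8 = 256 := by norm_num
        _ ≤ NX := hNX256
    exact le_of_pow_le_pow_left₀ (by norm_num) hw0.le this
  have hlogw : Real.log w = Real.log NX / 8 := by
    rw [hw, Real.log_rpow hNXpos]; ring
  set z : ℕ := ⌊w⌋₊ with hz
  have hzle : (z : ℝ) ≤ w := Nat.floor_le hw0.le
  have hzgt : w < z + 1 := Nat.lt_floor_add_one _
  have hz1r : (1 : ℝ) ≤ z := by
    have : (1 : ℕ) ≤ z := Nat.le_floor (by simp only [Nat.cast_one]; linarith)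
    exact_mod_cast this
  have hz1 : 1 ≤ z := by exact_mod_cast hz1r
  have hzpos : (0 : ℝ) < z := by linarith
  have hz8 : (z : ℝ) ^ 8 ≤ NX := by rw [← hw8]; exact pow_le_pow_left₀ (Nat.cast_nonneg z) hzle 8
  have hzhalfw : w / 2 ≤ z := by linarith
  have hlogz : a * Lx / 8 - 1 ≤ Real.log z := by
    have h1 : Real.log (w / 2) ≤ Real.log z := Real.log_le_log (by positivity) hzhalfw
    rw [Real.log_div hw0.ne' two_ne_zero, hlogw] at h1
    have := Real.log_two_lt_d9
    linarith
  -- `z ≤ NX` and `z ≤ x^{a/2}`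
  have hw_le_NX : w ≤ NX := by
    rw [hw]
    calc (NX : ℝ) ^ ((1 : ℝ) / 8) ≤ (NX : ℝ) ^ (1 : ℝ) :=
          Real.rpow_le_rpow_of_exponent_le (by exact_mod_cast hNX1) (by norm_num)
      _ = NX := Real.rpow_one _
  have hzNX : z ≤ NX := by exact_mod_cast hzle.trans hw_le_NX
  have hzhalf : (z : ℝ) ≤ x ^ (expoB / 2) := by
    rw [← ha]
    calc (z : ℝ) ≤ w := hzle
      _ = (NX : ℝ) ^ ((1 : ℝ) / 8) := hw
      _ ≤ (NX : ℝ) ^ ((1 : ℝ) / 2) := Real.rpow_le_rpow_of_exponent_le (by exact_mod_cast hNX1) (by norm_num)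
      _ ≤ (x ^ a) ^ ((1 : ℝ) / 2) := Real.rpow_le_rpow (Nat.cast_nonneg _) hNXle (by norm_num)
      _ = x ^ (a / 2) := by rw [← Real.rpow_mul hxpos.le]; ring_nf
  /- ── kernel parameters `A = 2T'`, `m = n + 3` and the saving ── -/
  set nK : ℕ := Module.finrank ℚ K with hnK'
  set m : ℕ := nK + 3 with hm
  have hm3 : Module.finrank ℚ K + 3 ≤ m := le_rfl
  have hn4 : (nK : ℝ) ≤ 4 := by exact_mod_cast hnK
  have hmcast : (m : ℝ) = nK + 3 := by rw [hm]; push_cast; ring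
  have hm8 : (m : ℝ) + 1 ≤ 8 := by rw [hmcast]; linarith
  have hA2 : 0 < 2 * T' := by positivity
  have hTA : ((m : ℝ) + 1) * T' ^ 2 ≤ 3 * (2 * T') ^ 2 := by nlinarith only [hm8, sq_nonneg T']
  have hmA : ((m : ℝ) + 1) / (2 * T') ≤ 4 := by
    rw [div_le_iff₀ hA2]; linarith
  obtain ⟨u₀, hu₀def⟩ : ∃ u : ℝ, u = balancePoint K (2 * T') m := ⟨_, rfl⟩
  have hu₀ : Fintype.card (ClassGroup (𝓞 K)) * lemma44Err K (2 * T') m u₀ ≤ NumberField.dedekindZeta_residue K / 2 := by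
    rw [hu₀def]; exact (card_mul_lemma44Err_balancePoint (K := K) (2 * T') m).le
  have hu₀le : u₀ ≤ 100 * Lp := by rw [hu₀def]; exact balancePoint_le hP hT'1 hT'2 hnK hd hh hκ
  have hden : a * Lx / 16 ≤ Real.log z - u₀ - ((m : ℝ) + 1) / (2 * T') := by linarith
  have hden1 : 1 ≤ Real.log z - u₀ - ((m : ℝ) + 1) / (2 * T') := by linarith
  -- `h_K M ≤ C_M / Lx`
  have hM : (Fintype.card (ClassGroup (𝓞 K)) : ℝ) * meanValueConst K (2 * T') m z NX ≤ C_M / Lx := by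
    have h1 := card_mul_meanValueConst_le (K := K) hA2 hm3 hz1r (NX : ℝ) hu₀ hden1
    have h2 := secondary_le (K := K) hP hT'1 hT'2 hnK hd hh hzpos.le hz8 (by exact_mod_cast hNX1)
    rw [← hw] at h2
    -- main term
    have hmain : 4 * ((m : ℝ) + 1) * Real.exp nK / (Real.log z - u₀ - ((m : ℝ) + 1) / (2 * T')) ≤ 512 * Real.exp 4 / a / Lx := by
      have hnum : 4 * ((m : ℝ) + 1) * Real.exp nK ≤ 32 * Real.exp 4 := by
        have he : Real.exp nK ≤ Real.exp 4 := Real.exp_le_exp.mpr hn4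
        have h0 : 0 ≤ Real.exp (nK : ℝ) := (Real.exp_pos _).le
        have h4 : 0 < Real.exp (4 : ℝ) := Real.exp_pos _
        nlinarith only [hm8, he, h0, h4]
      have h1 : 4 * ((m : ℝ) + 1) * Real.exp nK / (Real.log z - u₀ - ((m : ℝ) + 1) / (2 * T')) ≤
          32 * Real.exp 4 / (a * Lx / 16) := div_le_div₀ (by positivity) hnum (by positivity) hden
      refine h1.trans (le_of_eq ?_)
      field_simp
      ring
    -- secondary term `≤ 1/Lx`: `w ≥ P^{111} Lx`
    have hsec : P ^ 111 * w⁻¹ ≤ 1 / Lx := by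
      have hlogLx : Real.log Lx ≤ a * Lx / 16 := by
        have : 1500 / expoB ≤ Lx := by rw [div_le_iff₀ hapos, mul_comm]; exact haLx1500
        exact log_le_expoB_mul this
      have hwlow : P ^ 111 * Lx ≤ w := by
        have h3 : Real.log (P ^ 111 * Lx) ≤ Real.log w := by
          rw [Real.log_mul (by positivity) (by positivity), Real.log_pow, hlogw]
          push_cast
          linarith
        exact (Real.log_le_log_iff (by positivity) hw0).mp h3
      have hinv : w⁻¹ ≤ (P ^ 111 * Lx)⁻¹ := inv_anti₀ (by positivity) hwlow
      calc P ^ 111 * w⁻¹ ≤ P ^ 111 * (P ^ 111 * Lx)⁻¹ := mul_le_mul_of_nonneg_left hinv (by positivity)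
        _ = 1 / Lx := by field_simp
    calc (Fintype.card (ClassGroup (𝓞 K)) : ℝ) * meanValueConst K (2 * T') m z NX
        ≤ _ := h1
      _ ≤ 512 * Real.exp 4 / a / Lx + 1 / Lx := add_le_add hmain (h2.trans hsec)
      _ = C_M / Lx := by rw [hC_M]; field_simp
  /- ── the sieve side for every `t ∈ (NX, x]` ── -/
  set Bt : ℝ := 16 * π * C_M * Lx with hBt
  have hsieve : ∀ t ∈ Set.Ioc (NX : ℝ) x,
      ∑ ψ : AddChar (Additive (ClassGroup (𝓞 K))) ℂ,
        ∫ v in (-T')..T', ‖summatory (coefSiftedB (coefB K (toMulHom ψ).toHomUnits v) x z) t‖ ^ 2 ≤ Bt := by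
    intro t ht
    refine (sieveSide_classGroup x hz1 hzNX hT'pos hA2 hm3 hTA t).trans ?_
    have h2 : ∑ n ∈ (siftedSet x z).filter (fun n => n ≤ ⌊t⌋₊), Λ n * Real.log n / n ≤ 2 * Lx ^ 2 := by
      have hsub : (siftedSet x z).filter (fun n => n ≤ ⌊t⌋₊) ⊆ Icc 1 ⌊x⌋₊ := by
        intro n hn
        rw [mem_filter] at hn
        obtain ⟨h1, h2, -⟩ := siftedSet_prop hn.1
        rw [mem_Icc]; omega
      refine (sum_le_sum_of_subset_of_nonneg hsub fun n _ _ => ?_).trans ?_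
      · exact div_nonneg (mul_nonneg ArithmeticFunction.vonMangoldt_nonneg (Real.log_natCast_nonneg n)) (Nat.cast_nonneg n)
      refine (sum_vonMangoldt_mul_log_div_le ⌊x⌋₊).trans ?_
      have hfl : Real.log ⌊x⌋₊ ≤ Lx := by
        rw [← hlogx]
        rcases Nat.eq_zero_or_pos ⌊x⌋₊ with h0 | hpos
        · rw [h0, Nat.cast_zero, Real.log_zero, hlogx]; linarith
        · exact Real.log_le_log (by exact_mod_cast hpos) (Nat.floor_le hxpos.le)
      have hfl0 : 0 ≤ Real.log ⌊x⌋₊ := Real.log_natCast_nonneg _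
      have hl4 : Real.log 4 ≤ 1.4 := by
        have h : Real.log 4 = 2 * Real.log 2 := by
          rw [show (4:ℝ) = 2 ^ 2 by norm_num, Real.log_pow]; norm_num
        rw [h]; have := Real.log_two_lt_d9; linarith
      have h5 : Real.log ⌊x⌋₊ * (Real.log ⌊x⌋₊ + Real.log 4 + 2) ≤ Lx * (Lx + 4) :=
        mul_le_mul hfl (by linarith) (by linarith [Real.log_nonneg (by norm_num : (1:ℝ) ≤ 4)]) hLxnn
      nlinarith only [h5, hLx4]
    have hnK1 : 1 / (Module.finrank ℚ K : ℝ) ≤ 1 := by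
      rw [div_le_one (by exact_mod_cast Module.finrank_pos (R := ℚ) (M := K))]
      exact_mod_cast Module.finrank_pos (R := ℚ) (M := K)
    have hsum0 : 0 ≤ ∑ n ∈ (siftedSet x z).filter (fun n => n ≤ ⌊t⌋₊), Λ n * Real.log n / n :=
      sum_nonneg fun n _ => div_nonneg (mul_nonneg ArithmeticFunction.vonMangoldt_nonneg (Real.log_natCast_nonneg n)) (Nat.cast_nonneg n)
    calc 8 * π * ((Fintype.card (ClassGroup (𝓞 K)) : ℝ) * meanValueConst K (2 * T') m z ⌊x ^ expoB⌋₊ *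
          (1 / (Module.finrank ℚ K : ℝ) * ∑ n ∈ (siftedSet x z).filter (fun n => n ≤ ⌊t⌋₊), Λ n * Real.log n / n))
        ≤ 8 * π * (C_M / Lx * (1 * (2 * Lx ^ 2))) := by
          rw [← ha, ← hNX]
          refine mul_le_mul_of_nonneg_left ?_ (by positivity)
          refine mul_le_mul hM (mul_le_mul hnK1 h2 hsum0 zero_le_one) (by positivity) (by positivity)
      _ = Bt := by rw [hBt]; field_simp; ring
  /- ── the zero side for every `ψ ≠ 0` ── -/
  set L₀ : ℝ := Real.exp (-10) / (Module.finrank ℚ K : ℝ) ^ 2 * x ^ (-(r / 10)) / r ^ 3 with hL₀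
  have hnKpos : (0 : ℝ) < Module.finrank ℚ K := by exact_mod_cast Module.finrank_pos (R := ℚ) (M := K)
  have hL₀pos : 0 < L₀ := by rw [hL₀]; positivity
  have hLL' : ∀ v : ℝ, |v| ≤ T' → lemmaAHeight K v ≤ L' := by
    intro v hv
    refine (lemmaAHeight_le hP hnK hd (by rw [hT'] at hv; exact hv)).trans ?_
    rw [hL']; exact mul_le_mul_of_nonneg_right hB0 hLppos.le
  have hzero : ∀ ψ : AddChar (Additive (ClassGroup (𝓞 K))) ℂ, ψ ≠ 0 →
      r * L₀ * ∑ ρ ∈ Z (toMulHom ψ).toHomUnits with α ≤ ρ.re,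
          (zeroOrder (classGroupLFunction₀ K (toMulHom ψ).toHomUnits) ρ : ℝ) ≤
        C_z * (r * L') * ∫ v in (-T')..T', meanValueCG (toMulHom ψ).toHomUnits x z v := by
    intro ψ hψ
    have hχ1 : (toMulHom ψ).toHomUnits ≠ 1 := toHomUnits_ne_one hψ
    refine hZS K _ hχ1 hnK (hline _ hχ1) T' r L' x z _ hLL' hrpos hrr₀ hu hx1 hLxA₀ hzhalf hT'0 ?_
    intro ρ hρ
    rw [mem_filter] at hρ
    obtain ⟨h0, -, hre1, him⟩ := hZ _ hχ1 ρ hρ.1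
    refine ⟨h0, by rw [hr]; linarith [hρ.2], hre1, ?_⟩
    rw [hT', hr]; linarith
  /- ── summing over `ψ` ── -/
  set S : ℝ := ∑ ψ : AddChar (Additive (ClassGroup (𝓞 K))) ℂ with ψ ≠ 0,
      ∑ ρ ∈ Z (toMulHom ψ).toHomUnits with α ≤ ρ.re,
        (zeroOrder (classGroupLFunction₀ K (toMulHom ψ).toHomUnits) ρ : ℝ) with hS
  set f : AddChar (Additive (ClassGroup (𝓞 K))) ℂ → ℝ := fun ψ =>
      ∫ v in (-T')..T', meanValueCG (toMulHom ψ).toHomUnits x z v with hf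
  have hf0 : ∀ ψ, 0 ≤ f ψ := fun ψ =>
      intervalIntegral.integral_nonneg (by linarith) fun v _ => meanValueCG_nonneg _ x z v
  have hstep1 : r * L₀ * S ≤ C_z * (r * L') * ∑ ψ : AddChar (Additive (ClassGroup (𝓞 K))) ℂ, f ψ := by
    rw [hS, mul_sum, mul_sum]
    calc ∑ ψ ∈ univ.filter (fun ψ : AddChar (Additive (ClassGroup (𝓞 K))) ℂ => ψ ≠ 0),
          r * L₀ * ∑ ρ ∈ Z (toMulHom ψ).toHomUnits with α ≤ ρ.re,
            (zeroOrder (classGroupLFunction₀ K (toMulHom ψ).toHomUnits) ρ : ℝ)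
        ≤ ∑ ψ ∈ univ.filter (fun ψ : AddChar (Additive (ClassGroup (𝓞 K))) ℂ => ψ ≠ 0), C_z * (r * L') * f ψ := by
          refine sum_le_sum fun ψ hψ => ?_
          rw [mem_filter] at hψ
          exact hzero ψ hψ.2
      _ ≤ ∑ ψ : AddChar (Additive (ClassGroup (𝓞 K))) ℂ, C_z * (r * L') * f ψ :=
          sum_le_sum_of_subset_of_nonneg (filter_subset _ _) fun ψ _ _ => by
            exact mul_nonneg (by positivity) (hf0 ψ)
  -- Fubini and the sieve bound
  have hNXx : (NX : ℝ) ≤ x := by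
    refine hNXle.trans ?_
    exact Real.rpow_le_self_of_one_le hx1 (by linarith)
  have hstep3 : ∑ ψ : AddChar (Additive (ClassGroup (𝓞 K))) ℂ, f ψ ≤ Bt * Lx := by
    set g : AddChar (Additive (ClassGroup (𝓞 K))) ℂ → ℝ → ℝ := fun ψ t =>
      (∫ v in (-T')..T', ‖summatory (coefSiftedB (coefB K (toMulHom ψ).toHomUnits v) x z) t‖ ^ 2) / t with hg
    have hgi : ∀ ψ, IntegrableOn (g ψ) (Set.Ioc (NX : ℝ) x) :=
      fun ψ => integrableOn_inner_CG _ x z hNX1 hT'0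
    have heq : ∀ ψ, f ψ = ∫ t in Set.Ioc (NX : ℝ) x, g ψ t := by
      intro ψ
      rw [hf, hg]
      exact integral_meanValueCG_eq _ x z hNX1 hT'0
    rw [sum_congr rfl fun ψ _ => heq ψ, ← integral_finsetSum _ fun ψ _ => hgi ψ]
    have hBtint : IntegrableOn (fun t : ℝ => Bt * t⁻¹) (Set.Ioc (NX : ℝ) x) := by
      refine ((continuousOn_const.mul (continuousOn_inv₀.mono ?_)).integrableOn_compact isCompact_Icc).mono_set
        Set.Ioc_subset_Icc_self
      intro t ht; exact (hNXpos.trans_le ht.1).ne'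
    calc ∫ t in Set.Ioc (NX : ℝ) x, ∑ ψ : AddChar (Additive (ClassGroup (𝓞 K))) ℂ, g ψ t
        ≤ ∫ t in Set.Ioc (NX : ℝ) x, Bt * t⁻¹ := by
          refine setIntegral_mono_on (integrable_finsetSum _ fun ψ _ => hgi ψ)
            hBtint measurableSet_Ioc fun t ht => ?_
          have ht0 : 0 < t := hNXpos.trans ht.1
          have h1 := hsieve t ht
          have h2 : ∑ ψ : AddChar (Additive (ClassGroup (𝓞 K))) ℂ, g ψ t =
              (∑ ψ : AddChar (Additive (ClassGroup (𝓞 K))) ℂ,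
                ∫ v in (-T')..T', ‖summatory (coefSiftedB (coefB K (toMulHom ψ).toHomUnits v) x z) t‖ ^ 2) / t := by
            rw [sum_div]
          rw [h2, div_eq_mul_inv]
          exact mul_le_mul_of_nonneg_right h1 (inv_nonneg.2 ht0.le)
      _ = Bt * Real.log (x / NX) := by
          rw [integral_const_mul, ← intervalIntegral.integral_of_le hNXx, integral_inv_of_pos hNXpos hxpos]
      _ ≤ Bt * Lx := by
          refine mul_le_mul_of_nonneg_left ?_ (by positivity)
          rw [Real.log_div hxpos.ne' hNXpos.ne', hlogx]
          linarith [Real.log_nonneg (show (1:ℝ) ≤ NX by exact_mod_cast hNX1)]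
  have hmain := hstep1.trans (mul_le_mul_of_nonneg_left hstep3 (by positivity))
  /- ── the final arithmetic ── -/
  -- `C_z (rL') (Bt Lx) = r (256π C_z C_M A₁² B³) Lp³ / 16 · 16`: we bound `L₀ ≥ e^{-10} x^{-r/10}/(16 r³)`
  have hK : C_z * (r * L') * (Bt * Lx) = r * (K₁ * Lp ^ 3) / 16 := by
    rw [hBt, hLx, hL', hK₁]; field_simp; ring
  rw [hK] at hmain
  have hL₀low : Real.exp (-10) * x ^ (-(r / 10)) / r ^ 3 / 16 ≤ L₀ := by
    have hn16 : (Module.finrank ℚ K : ℝ) ^ 2 ≤ 16 := by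
      have h4 : (Module.finrank ℚ K : ℝ) ≤ 4 := by exact_mod_cast hnK
      nlinarith only [h4, hnKpos]
    have heq : L₀ = Real.exp (-10) * x ^ (-(r / 10)) / r ^ 3 / (Module.finrank ℚ K : ℝ) ^ 2 := by
      rw [hL₀]; field_simp
    rw [heq]
    exact div_le_div_of_nonneg_left (by positivity) (by positivity) hn16
  -- divide by `r L₀`
  set L₁ : ℝ := Real.exp (-10) * x ^ (-(r / 10)) / r ^ 3 with hL₁
  have hL₁pos : 0 < L₁ := by positivity
  have hdiv : S ≤ K₁ * Lp ^ 3 / L₁ := by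
    have h1 : r * (L₁ / 16) * S ≤ r * (K₁ * Lp ^ 3) / 16 := by
      have := mul_le_mul_of_nonneg_left (mul_le_mul_of_nonneg_right hL₀low (show 0 ≤ S from by
        rw [hS]; exact sum_nonneg fun ψ _ => sum_nonneg fun ρ _ => Nat.cast_nonneg _)) hrpos.le
      calc r * (L₁ / 16) * S = r * (Real.exp (-10) * x ^ (-(r / 10)) / r ^ 3 / 16 * S) := by rw [hL₁]; ring
        _ ≤ r * (L₀ * S) := this
        _ = r * L₀ * S := by ring
        _ ≤ _ := hmain
    rw [le_div_iff₀ hL₁pos]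
    have h2 := le_of_mul_le_mul_left (show r * (L₁ / 16 * S) ≤ r * (K₁ * Lp ^ 3 / 16) by
      calc r * (L₁ / 16 * S) = r * (L₁ / 16) * S := by ring
        _ ≤ r * (K₁ * Lp ^ 3) / 16 := h1
        _ = r * (K₁ * Lp ^ 3 / 16) := by ring) hrpos
    have h3 := mul_le_mul_of_nonneg_left h2 (by norm_num : (0:ℝ) ≤ 16)
    linarith
  refine hdiv.trans ?_
  have hxr : x ^ (r / 10) = Real.exp (A₁ * B / 10 * r * Lp) := by
    rw [hx, ← Real.exp_mul, hLx, hL']; ring_nf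
  have hL₁eq : K₁ * Lp ^ 3 / L₁ = K₁ * Real.exp 10 * ((r * Lp) ^ 3 * x ^ (r / 10)) := by
    rw [hL₁, Real.rpow_neg hxpos.le, Real.exp_neg]
    have hx10 : 0 < x ^ (r / 10) := by positivity
    field_simp
  rw [hL₁eq]
  have hcube : (r * Lp) ^ 3 ≤ Real.exp (3 * (r * Lp)) := cube_le_exp (by positivity)
  have hPpow : P ^ ((A₁ * B / 10 + 3) * 2 * (1 - α)) =
      Real.exp (3 * (r * Lp)) * Real.exp (A₁ * B / 10 * r * Lp) := by
    rw [Real.rpow_def_of_pos hPpos, ← Real.exp_add, ← hLp, hr]; ring_nf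
  rw [hPpow, hxr]
  refine mul_le_mul_of_nonneg_left ?_ (by positivity)
  exact mul_le_mul_of_nonneg_right hcube (Real.exp_pos _).le

end Literature.NumberTheory.LFunctions.NumberField

end
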